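import Mathlib
import HarnessLib
import Literature.Geometry.DiscreteGeometry.BondGraph
import Literature.Geometry.DiscreteGeometry.KissingPatterns
import Summits.AtomisticToContinuum.Crystallization.Theorems.PricedLinkCensusSoftLayerPropagationStubChartAssembly
import Summits.AtomisticToContinuum.Crystallization.Theorems.PricedLinkCensusSoftLayerPropagationH1RSiteTools
import Summits.AtomisticToContinuum.Crystallization.Theorems.PricedLinkCensusSoftLayerPropagationH1RApex
import Summits.AtomisticToContinuum.Crystallization.Theorems.PalmUnimodularRigidityShellsToBarlowChartCharts

/-!
# Label-level tools for the ordered-caps lemma (crux `SoftLayerPropagation`, line `Sketch`, stub `develop_H1R`)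

Route `PricedLinkCensus`, crux `SoftLayerPropagation` (stmt-AtomisticToContinuum-14233), line `Sketch`.
Helper file for the registered stub `develop_H1R` (metric ordered caps).  The chart of the anchor site
`t` over the integer model `(S, N)` (labels `v ↦ m (v/√N)`), read as: adjacency to `t` and closeness to
the ideal position (`h1r_Z2`), injectivity (`h1r_Z3`), bonds among labelled sites = model contacts
(`h1r_Z4`); the far apex of a labelled square in integer form (`h1r_far_apex_int`, from
`Theorems.h1r_far_apex`; evenness/symmetry of the model norm is reused from
`…PalmUnimodularRigidityShellsToBarlowChartCharts`); and the COARSE A-PRIORI BOUNDS fed to the cap and bipyramid lemmas: a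
rational label identity (`2 v_P = (v_A − v_A') + (v_M − v_M')`, resp. `3 (v_Q + v_M) = 2 (v_A + v_P)`)
makes the ideal positions cancel exactly, leaving chart errors of total weight `3 · nn_t/4`, resp.
`(10/3) · nn_t/4` (`h1r_apriori_cap`, `h1r_apriori_bip`).  All `[folklore]`.
-/

noncomputable section

namespace Summit.AtomisticToContinuum.Crystallization.Theorems

open Literature.Geometry.DiscreteGeometry RealInnerProductSpace

variable {η : ℝ} {n : ℕ} {y : Fin n → EuclideanSpace ℝ (Fin 3)}

/-! ### The chart of `t` over the integer model -/

/-- Labels of the integer model are pattern points. [folklore] -/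
theorem h1r_memS {S : Finset (Fin 3 → ℤ)} {N : ℕ} {P : Finset (EuclideanSpace ℝ (Fin 3))}
    (hPS : P = scaledPattern S N) {v : Fin 3 → ℤ} (hv : v ∈ S) :
    ((Real.sqrt N)⁻¹ • intVec v : EuclideanSpace ℝ (Fin 3)) ∈ P := by
  rw [hPS]; exact Finset.mem_image_of_mem _ hv

/-- `Z2`: labelled sites are bonded to the centre and close to their ideal positions. [folklore] -/
theorem h1r_Z2 {S : Finset (Fin 3 → ℤ)} {N : ℕ} {P : Finset (EuclideanSpace ℝ (Fin 3))}
    {t : Fin n} {A : EuclideanSpace ℝ (Fin 3) →ₗᵢ[ℝ] EuclideanSpace ℝ (Fin 3)}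
    {m : EuclideanSpace ℝ (Fin 3) → Fin n} (hPS : P = scaledPattern S N)
    (C2 : ∀ p ∈ P, (bondGraph η y).Adj t (m p) ∧ dist (y (m p)) (y t + nearestDist y t • A p) ≤ nearestDist y t / 4) :
    ∀ v ∈ S, (bondGraph η y).Adj t (m ((Real.sqrt N)⁻¹ • intVec v)) ∧
      dist (y (m ((Real.sqrt N)⁻¹ • intVec v))) (y t + nearestDist y t • A ((Real.sqrt N)⁻¹ • intVec v)) ≤
        nearestDist y t / 4 :=
  fun _ hv => C2 _ (h1r_memS hPS hv)

/-- `Z3`: labels are injective. [folklore] -/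
theorem h1r_Z3 {S : Finset (Fin 3 → ℤ)} {N : ℕ} (hN : N ≠ 0) {P : Finset (EuclideanSpace ℝ (Fin 3))}
    {m : EuclideanSpace ℝ (Fin 3) → Fin n} (hPS : P = scaledPattern S N)
    (C3 : ∀ p ∈ P, ∀ q ∈ P, m p = m q → p = q) :
    ∀ v ∈ S, ∀ w ∈ S, m ((Real.sqrt N)⁻¹ • intVec v) = m ((Real.sqrt N)⁻¹ • intVec w) → v = w :=
  fun _ hv _ hw h => scaledPattern_map_injective hN (C3 _ (h1r_memS hPS hv) _ (h1r_memS hPS hw) h)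

/-- `Z4`: bonds among labelled sites are exactly the model contacts. [folklore] -/
theorem h1r_Z4 {S : Finset (Fin 3 → ℤ)} {N : ℕ} (hN : N ≠ 0) {P : Finset (EuclideanSpace ℝ (Fin 3))}
    {m : EuclideanSpace ℝ (Fin 3) → Fin n} (hPS : P = scaledPattern S N)
    (C4 : ∀ p ∈ P, ∀ q ∈ P, ((bondGraph η y).Adj (m p) (m q) ↔ dist p q = 1)) :
    ∀ v ∈ S, ∀ w ∈ S, ((bondGraph η y).Adj (m ((Real.sqrt N)⁻¹ • intVec v)) (m ((Real.sqrt N)⁻¹ • intVec w)) ↔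
      sqNormInt (v - w) = N) := fun v hv w hw => by
  rw [C4 _ (h1r_memS hPS hv) _ (h1r_memS hPS hw), dist_scaled_intVec_eq_one_iff hN]

/-! ### The far apex of a labelled square, integer form -/

/-- **The far apex in integer form (`h1r_far_apex_int`).**  At a site `t` of positive scale whose
bond-neighbours carry charts, with a chart `(P, A, m)` at `t` over the integer model `(S, N)`: every
labelled `4`-cycle `v₁ ~ v₂ ~ v₃ ~ v₄ ~ v₁` of model contacts with `v₁, v₃` and `v₂, v₄` distinct
non-contacts has a far apex `z` bonded to the four labelled sites, with `z ≠ t`. [folklore] -/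
theorem h1r_far_apex_int (hη0 : 0 ≤ η) (hη1 : η ≤ 1) {t : Fin n} (hnn : 0 < nearestDist y t)
    (charts : ∀ j : Fin n, (bondGraph η y).Adj t j →
      ∃ (P : Finset (EuclideanSpace ℝ (Fin 3))) (A : EuclideanSpace ℝ (Fin 3) →ₗᵢ[ℝ] EuclideanSpace ℝ (Fin 3))
        (m : EuclideanSpace ℝ (Fin 3) → Fin n),
        (P = fccKissingPattern ∨ P = hcpKissingPattern) ∧
        (∀ p ∈ P, (bondGraph η y).Adj j (m p) ∧ dist (y (m p)) (y j + nearestDist y j • A p) ≤ nearestDist y j / 4) ∧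
        (∀ p ∈ P, ∀ q ∈ P, m p = m q → p = q) ∧
        (∀ p ∈ P, ∀ q ∈ P, ((bondGraph η y).Adj (m p) (m q) ↔ dist p q = 1)) ∧
        (∀ l, (bondGraph η y).Adj j l → ∃ p ∈ P, m p = l))
    {P : Finset (EuclideanSpace ℝ (Fin 3))} {A : EuclideanSpace ℝ (Fin 3) →ₗᵢ[ℝ] EuclideanSpace ℝ (Fin 3)}
    {m : EuclideanSpace ℝ (Fin 3) → Fin n} (hP : P = fccKissingPattern ∨ P = hcpKissingPattern)
    (C2 : ∀ p ∈ P, (bondGraph η y).Adj t (m p) ∧ dist (y (m p)) (y t + nearestDist y t • A p) ≤ nearestDist y t / 4)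
    (C3 : ∀ p ∈ P, ∀ q ∈ P, m p = m q → p = q)
    (C4 : ∀ p ∈ P, ∀ q ∈ P, ((bondGraph η y).Adj (m p) (m q) ↔ dist p q = 1))
    (C5 : ∀ l, (bondGraph η y).Adj t l → ∃ p ∈ P, m p = l)
    {S : Finset (Fin 3 → ℤ)} {N : ℕ} (hN : N ≠ 0) (hPS : P = scaledPattern S N)
    {v₁ v₂ v₃ v₄ : Fin 3 → ℤ} (h₁ : v₁ ∈ S) (h₂ : v₂ ∈ S) (h₃ : v₃ ∈ S) (h₄ : v₄ ∈ S)
    (c12 : sqNormInt (v₁ - v₂) = N) (c23 : sqNormInt (v₂ - v₃) = N) (c34 : sqNormInt (v₃ - v₄) = N)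
    (c41 : sqNormInt (v₄ - v₁) = N) (n13 : v₁ ≠ v₃) (d13 : sqNormInt (v₁ - v₃) ≠ N) (n24 : v₂ ≠ v₄)
    (d24 : sqNormInt (v₂ - v₄) ≠ N) :
    ∃ z : Fin n, (bondGraph η y).Adj (m ((Real.sqrt N)⁻¹ • intVec v₁)) z ∧
      (bondGraph η y).Adj (m ((Real.sqrt N)⁻¹ • intVec v₂)) z ∧
      (bondGraph η y).Adj (m ((Real.sqrt N)⁻¹ • intVec v₃)) z ∧
      (bondGraph η y).Adj (m ((Real.sqrt N)⁻¹ • intVec v₄)) z ∧ t ≠ z := by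
  have e := fun (v w : Fin 3 → ℤ) => (dist_scaled_intVec_eq_one_iff hN v w)
  have inj := scaledPattern_map_injective (N := N) hN
  obtain ⟨z, a1, a2, a3, a4, -, ne⟩ := h1r_far_apex η hη0 hη1 n y t hnn charts P A m hP C2 C3 C4 C5
    _ (h1r_memS hPS h₁) _ (h1r_memS hPS h₂) _ (h1r_memS hPS h₃) _ (h1r_memS hPS h₄)
    ((e _ _).2 c12) ((e _ _).2 c23) ((e _ _).2 c34) ((e _ _).2 c41)
    (fun h => n13 (inj h)) (fun h => d13 ((e _ _).1 h)) (fun h => n24 (inj h)) (fun h => d24 ((e _ _).1 h))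
  exact ⟨z, a1, a2, a3, a4, ne⟩

/-! ### The coarse a-priori bounds from the chart of `t` -/

/-- Closeness to the ideal position, norm form with the scale pulled out of the isometry. [folklore] -/
theorem h1r_close_norm {t j : Fin n} {ν c : ℝ} {A : EuclideanSpace ℝ (Fin 3) →ₗᵢ[ℝ] EuclideanSpace ℝ (Fin 3)}
    {v : Fin 3 → ℤ} (h : dist (y j) (y t + ν • A (c • intVec v)) ≤ ν / 4) :
    ‖y j - (y t + ν • (c • A (intVec v)))‖ ≤ ν / 4 := by
  rwa [← LinearIsometry.map_smul, ← dist_eq_norm]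

/-- **A-priori bound for a cap.**  If `2 v_P = (v_A − v_A') + (v_M − v_M')` in the integer model then
the labelled sites satisfy `‖(y_P − y_t) − ½(y_A − y_A') − ½(y_M − y_M')‖ ≤ ¾ nn_t`. [folklore] -/
theorem h1r_apriori_cap {t jP jA jA' jM jM' : Fin n} {ν c : ℝ}
    {A : EuclideanSpace ℝ (Fin 3) →ₗᵢ[ℝ] EuclideanSpace ℝ (Fin 3)} {vP vA vA' vM vM' : Fin 3 → ℤ}
    (hP : dist (y jP) (y t + ν • A (c • intVec vP)) ≤ ν / 4)
    (hA : dist (y jA) (y t + ν • A (c • intVec vA)) ≤ ν / 4)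
    (hA' : dist (y jA') (y t + ν • A (c • intVec vA')) ≤ ν / 4)
    (hM : dist (y jM) (y t + ν • A (c • intVec vM)) ≤ ν / 4)
    (hM' : dist (y jM') (y t + ν • A (c • intVec vM')) ≤ ν / 4)
    (hid : (2 : ℤ) • vP = (vA - vA') + (vM - vM')) :
    ‖(y jP - y t - (1 / 2 : ℝ) • y jA + (1 / 2 : ℝ) • y jA' - (1 / 2 : ℝ) • y jM + (1 / 2 : ℝ) • y jM')‖ ≤ 3 / 4 * ν := by
  have gP := h1r_close_norm hP
  have gA := h1r_close_norm hA
  have gA' := h1r_close_norm hA'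
  have gM := h1r_close_norm hM
  have gM' := h1r_close_norm hM'
  have hν : 0 ≤ ν := by linarith [norm_nonneg (y jP - (y t + ν • (c • A (intVec vP))))]
  have hz : intVec vP - (1 / 2 : ℝ) • intVec vA + (1 / 2 : ℝ) • intVec vA' - (1 / 2 : ℝ) • intVec vM +
      (1 / 2 : ℝ) • intVec vM' = 0 := by
    ext i
    have h := congrFun hid i
    simp only [Pi.smul_apply, Pi.add_apply, Pi.sub_apply, smul_eq_mul] at h
    simp only [PiLp.add_apply, PiLp.sub_apply, PiLp.smul_apply, intVec_apply, smul_eq_mul, PiLp.zero_apply]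
    have h' : (2 : ℝ) * (vP i : ℝ) = ((vA i : ℝ) - vA' i) + ((vM i : ℝ) - vM' i) := by exact_mod_cast h
    linarith
  have hu : A (intVec vP) - (1 / 2 : ℝ) • A (intVec vA) + (1 / 2 : ℝ) • A (intVec vA') - (1 / 2 : ℝ) • A (intVec vM) +
      (1 / 2 : ℝ) • A (intVec vM') = 0 := by
    have h := congrArg A hz
    simp only [map_add, map_sub, LinearIsometry.map_smul, map_zero] at h
    exact h
  have key : (y jP - y t - (1 / 2 : ℝ) • y jA + (1 / 2 : ℝ) • y jA' - (1 / 2 : ℝ) • y jM + (1 / 2 : ℝ) • y jM') =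
      (1 : ℝ) • (y jP - (y t + ν • (c • A (intVec vP)))) + (-(1 / 2) : ℝ) • (y jA - (y t + ν • (c • A (intVec vA)))) +
      (1 / 2 : ℝ) • (y jA' - (y t + ν • (c • A (intVec vA')))) + (-(1 / 2) : ℝ) • (y jM - (y t + ν • (c • A (intVec vM)))) +
      (1 / 2 : ℝ) • (y jM' - (y t + ν • (c • A (intVec vM')))) +
      (ν * c) • (A (intVec vP) - (1 / 2 : ℝ) • A (intVec vA) + (1 / 2 : ℝ) • A (intVec vA') - (1 / 2 : ℝ) • A (intVec vM) +
        (1 / 2 : ℝ) • A (intVec vM')) := by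
    module
  rw [hu, smul_zero, add_zero] at key
  have h := h1r_norm_combo5 key gP gA gA' gM gM'
  refine h.trans ?_
  norm_num
  linarith

/-- **A-priori bound for a second-generation apex.**  If `3 (v_Q + v_M) = 2 (v_A + v_P)` in the integer
model then `‖y_Q + y_M − (2/3)(y_t + y_A + y_P)‖ ≤ (5/6) nn_t`. [folklore] -/
theorem h1r_apriori_bip {t jQ jM jA jP : Fin n} {ν c : ℝ}
    {A : EuclideanSpace ℝ (Fin 3) →ₗᵢ[ℝ] EuclideanSpace ℝ (Fin 3)} {vQ vM vA vP : Fin 3 → ℤ}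
    (hQ : dist (y jQ) (y t + ν • A (c • intVec vQ)) ≤ ν / 4)
    (hM : dist (y jM) (y t + ν • A (c • intVec vM)) ≤ ν / 4)
    (hA : dist (y jA) (y t + ν • A (c • intVec vA)) ≤ ν / 4)
    (hP : dist (y jP) (y t + ν • A (c • intVec vP)) ≤ ν / 4)
    (hid : (3 : ℤ) • (vQ + vM) = (2 : ℤ) • (vA + vP)) :
    ‖(y jQ + y jM - (2 / 3 : ℝ) • y t - (2 / 3 : ℝ) • y jA - (2 / 3 : ℝ) • y jP)‖ ≤ 5 / 6 * ν := by
  have gQ := h1r_close_norm hQ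
  have gM := h1r_close_norm hM
  have gA := h1r_close_norm hA
  have gP := h1r_close_norm hP
  have hν : 0 ≤ ν := by linarith [norm_nonneg (y jP - (y t + ν • (c • A (intVec vP))))]
  have hz : intVec vQ + intVec vM - (2 / 3 : ℝ) • intVec vA - (2 / 3 : ℝ) • intVec vP = 0 := by
    ext i
    have h := congrFun hid i
    simp only [Pi.smul_apply, Pi.add_apply, smul_eq_mul] at h
    simp only [PiLp.add_apply, PiLp.sub_apply, PiLp.smul_apply, intVec_apply, smul_eq_mul, PiLp.zero_apply]
    have h' : (3 : ℝ) * ((vQ i : ℝ) + vM i) = 2 * ((vA i : ℝ) + vP i) := by exact_mod_cast h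
    linarith
  have hu : A (intVec vQ) + A (intVec vM) - (2 / 3 : ℝ) • A (intVec vA) - (2 / 3 : ℝ) • A (intVec vP) = 0 := by
    have h := congrArg A hz
    simp only [map_add, map_sub, LinearIsometry.map_smul, map_zero] at h
    exact h
  have key : (y jQ + y jM - (2 / 3 : ℝ) • y t - (2 / 3 : ℝ) • y jA - (2 / 3 : ℝ) • y jP) =
      (1 : ℝ) • (y jQ - (y t + ν • (c • A (intVec vQ)))) + (1 : ℝ) • (y jM - (y t + ν • (c • A (intVec vM)))) +
      (-(2 / 3) : ℝ) • (y jA - (y t + ν • (c • A (intVec vA)))) + (-(2 / 3) : ℝ) • (y jP - (y t + ν • (c • A (intVec vP)))) +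
      (ν * c) • (A (intVec vQ) + A (intVec vM) - (2 / 3 : ℝ) • A (intVec vA) - (2 / 3 : ℝ) • A (intVec vP)) := by
    module
  rw [hu, smul_zero, add_zero] at key
  have h := h1r_norm_combo4 key gQ gM gA gP
  refine h.trans ?_
  norm_num
  linarith

/-- The unit of the site lemmas: `ℓ = nn_t / 1.01`. [folklore] -/
theorem h1r_unit {t : Fin n} (hnn : 0 < nearestDist y t) :
    0 < nearestDist y t / (101 / 100) ∧ nearestDist y t = 101 / 100 * (nearestDist y t / (101 / 100)) := by
  refine ⟨by positivity, ?_⟩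
  field_simp

/-- **Registered principal of this tools file (`h1r_lab_unit`)**: the unit of the site lemmas in arrow
form (the other lemmas of the file are the tools listed in the module docstring). [folklore] -/
theorem h1r_lab_unit : ∀ (n : ℕ) (y : Fin n → EuclideanSpace ℝ (Fin 3)) (t : Fin n), 0 < nearestDist y t → 0 < nearestDist y t / (101 / 100) ∧ nearestDist y t = 101 / 100 * (nearestDist y t / (101 / 100)) :=
  fun _ _ _ h => h1r_unit h

end Summit.AtomisticToContinuum.Crystallization.Theorems

end
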